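import Mathlib.Algebra.BigOperators.Group.Finset.Basic
import Mathlib.Data.Fintype.Basic
import Literature.Computability.Complexity.CNF
import Literature.Computability.MetaComplexity.CuttingPlanes
import HarnessLib

/-!
# Semantic refutations whose lines are disjunctions of integer linear atoms

The common semantic envelope of the "resolution over linear arithmetic" systems of
Krajíček 2019, §7.1: a LINE is a disjunction of finitely many LINEAR ATOMS, an atom being an
integer linear inequality `b ≤ ∑ a_v x_v` (the atoms of `R(CP)`, §7.1.1 — a negated
CP-inequality is again one) or an integer linear equation `∑ a_v x_v = b` (the atoms of
`Res(lin_ℤ)` / `Res(lin_ℚ)` after clearing denominators; `R(LIN)` of §7.1.3 is the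
`𝔽₂` analogue and lives in `ResLin.lean`).  We do NOT fix inference rules: following Krajíček 2019,
§17.5 (semantic derivations), a refutation of a CNF `φ` is a sequence of lines each of which is
implied by ONE clause of `φ` or follows SEMANTICALLY (as sets of satisfying assignments,
`E_j ⊇ E_{i₁} ∩ E_{i₂}`, `i₁, i₂ < j`) from at most two earlier lines, and which contains the
empty line.  Every syntactic `R(CP)`, `R(CP*)`, `Res(lin_ℚ)`, `Res(k)` refutation is one
(soundness of binary rules, §17.5), so size lower bounds for `IsSemLinRefutation` are lower
bounds for all of them simultaneously.  Size = number of atom occurrences plus number of lines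
(`semLinSize`); coefficients are NOT charged (the semantic setting of §17.5).

## References
* J. Krajíček, *Proof complexity*, CUP 2019, §7.1.1 (R(CP)), §7.1.3, §17.5 (semantic
  derivations), §22 (the lower-bound problem for R(CP), R(LIN)) [KrajicekProofComplexity2019].

Not here: the syntactic rules of R(CP) / Res(lin_R); simulations; any lower bound.
-/

namespace Literature.Computability.MetaComplexity

open Finset Literature.Computability.Complexity

/-- A linear atom over Boolean variables `ν`: the integer linear form `∑_v coeff v · x_v`
compared with `const` — as the inequality `const ≤ ∑_v coeff v · x_v` when `isEq = false`
(a CP-inequality, the atoms of `R(CP)`) and as the equation `∑_v coeff v · x_v = const` when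
`isEq = true` (the atoms of resolution over linear equations in characteristic zero).
[cite: KrajicekProofComplexity2019, §7.1.1] -/
structure LinAtom (ν : Type*) where
  /-- the coefficients `a_v` -/
  coeff : ν → ℤ
  /-- the constant `b` -/
  const : ℤ
  /-- `true` for an equation atom, `false` for an inequality atom -/
  isEq : Bool

namespace LinAtom

variable {ν : Type*} [Fintype ν]

/-- The value `∑_v a_v · x_v` of the linear form of an atom at a Boolean assignment
(`CPLine.bit σ v ∈ {0,1}`). [cite: KrajicekProofComplexity2019, §7.1.1] -/
def form (a : LinAtom ν) (σ : ν → Bool) : ℤ :=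
  ∑ v, a.coeff v * CPLine.bit σ v

/-- An atom HOLDS at `σ`: `∑ a_v x_v = b` (equation atom) resp. `b ≤ ∑ a_v x_v` (inequality
atom). [cite: KrajicekProofComplexity2019, §7.1.1] -/
def Holds (a : LinAtom ν) (σ : ν → Bool) : Prop :=
  if a.isEq then a.form σ = a.const else a.const ≤ a.form σ

end LinAtom

/-- A line: a finite disjunction of linear atoms (a clause of CP-inequalities in `R(CP)`, a
disjunction of linear equations in `Res(lin_R)`); the empty line is the contradiction.
[cite: KrajicekProofComplexity2019, §7.1.1] -/
abbrev LinLine (ν : Type*) := List (LinAtom ν)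

namespace LinLine

variable {ν : Type*} [Fintype ν]

/-- A line holds at `σ` iff one of its atoms does. [cite: KrajicekProofComplexity2019, §7.1.1] -/
def Holds (u : LinLine ν) (σ : ν → Bool) : Prop :=
  ∃ a ∈ u, a.Holds σ

/-- The empty line holds nowhere. [folklore] -/
theorem not_holds_nil (σ : ν → Bool) : ¬ LinLine.Holds ([] : LinLine ν) σ := by
  rintro ⟨a, ha, -⟩; simp at ha

end LinLine

section Semantic

variable {ν : Type*} [Fintype ν]

/-- `π` is a SEMANTIC linear-atom refutation of the CNF `φ` (Krajíček 2019, §17.5 specialised to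
the class of sets definable by disjunctions of linear atoms): every line is implied by a single
clause of `φ` (an axiom) or is a semantic consequence of at most two EARLIER lines (the semantic
rule `E_j ⊇ E_{i₁} ∩ E_{i₂}`; `i₁ = i₂` allowed), and the empty line occurs.  Soundness is with
respect to all Boolean assignments.  Contains every `R(CP)`, `R(CP*)`, `Res(lin_ℚ)`, `Res(k)`
refutation read line by line. [cite: KrajicekProofComplexity2019, §17.5] -/
def IsSemLinRefutation (φ : CNF ν) (π : List (LinLine ν)) : Prop :=
  (∀ i : Fin π.length,
      (∃ c ∈ φ, ∀ σ : ν → Bool, c.eval σ = true → (π.get i).Holds σ) ∨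
      (∃ j : Fin π.length, ∃ j' : Fin π.length, j.val < i.val ∧ j'.val < i.val ∧
        ∀ σ : ν → Bool, (π.get j).Holds σ → (π.get j').Holds σ → (π.get i).Holds σ)) ∧
  ([] : LinLine ν) ∈ π

/-- The size of a linear-atom refutation: the number of atom occurrences plus the number of
lines (so that empty and unit lines are charged); coefficients are not charged.
[cite: KrajicekProofComplexity2019, §17.5] -/
def semLinSize (π : List (LinLine ν)) : ℕ :=
  (π.map fun u => u.length + 1).sum

/-- Soundness: a CNF with a semantic linear-atom refutation is unsatisfiable (induction along
the sequence: every line holds at a satisfying assignment, the empty line does not).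
[cite: KrajicekProofComplexity2019, §17.5] -/
theorem not_satisfiable_of_isSemLinRefutation {φ : CNF ν} {π : List (LinLine ν)}
    (h : IsSemLinRefutation φ π) : ¬ φ.Satisfiable := by
  rintro ⟨σ, hσ⟩
  obtain ⟨hstep, hnil⟩ := h
  -- every line holds at σ, by strong induction on the position
  have key : ∀ n : ℕ, ∀ i : Fin π.length, i.val = n → (π.get i).Holds σ := by
    intro n
    induction n using Nat.strong_induction_on with
    | _ n ih =>
      intro i hi
      rcases hstep i with ⟨c, hc, himp⟩ | ⟨j, j', hj, hj', himp⟩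
      · exact himp σ ((CNF.eval_eq_true_iff φ σ).1 hσ c hc)
      · exact himp σ (ih j.val (hi ▸ hj) j rfl) (ih j'.val (hi ▸ hj') j' rfl)
  obtain ⟨i, hi⟩ := List.mem_iff_get.1 hnil
  have := key i.val i rfl
  rw [hi] at this
  exact LinLine.not_holds_nil σ this

end Semantic

end Literature.Computability.MetaComplexity
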